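import Summits.QuantumFields.YangMills.Theorems.UnitScaleTiltProp7SectET3WCurrentRealityT3
import Summits.QuantumFields.YangMills.Theorems.UnitScaleTiltProp7SectET3WCurrentProp4RowsT3
import Summits.QuantumFields.YangMills.Theorems.UnitScaleTiltProp7SectET3SlotCurrentRowsT3
import Summits.QuantumFields.YangMills.Theorems.UnitScaleTiltProp7SectET3RealityPInvT3
import HarnessLib

/-!
# Route `UnitScaleTilt`, crux K1 child «MinimiserStabilityRegPr» (stmt-QuantumFields-19200), stub `stub_existenceMinimalOrbit` (EX), route (α) — THE (W-X′) INSTANTIATION OF THE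
# DISPLAY'S `Wf`: **THE REALITY ROW `hWR` AT THE LETTERS OF RECORD, EVERY LOCATED-✓ ROW PLUGGED BY NAME** — `H̃ := H1f … DeltaPiSlotP … U₀` (EX namer ★w2-19200 g7 WORD (9) 2026-08-28T23:58:13Z: the (115)-reader of the
# CHART's `H = H46P`, print's `H` of (47)∕(80)), `C̃ := fun A′ ↦ (−I) • CmapTwS U₀ ((η·I) • ιA′)` with `Prop4Hyp C̃ (40·(2·(3·(2e+2700Lε₀)))∕e²) (e∕2)` ✓p664073, `Δ̃π := currentCLM frobEquiv (fun _ ↦ K−n) (nabla115 η (bgOfCfg F K U₀))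
# (DeltaEtaSlot F n K c₀ U₀)` with its sector row ✓p678511; displayed: the Sect. C regime, (Z-C) central invariance of `C̃`, (R-V₀)

Cell `ym3-torus`, width seat `ym3-torus-px3` (gen 3; LOCATE «HWR-AT-W80»).  THEOREMS ONLY (0 `def`, 0 `sorry`); `--supports stmt-QuantumFields-19200 --as helper`; count-neutral.  YM₃ on T³ is a
ladder rung (R3), NOT the Clay problem; nothing here claims the stub, the crux, d = 4 or the mass gap.

THE PRINT.  [Balaban1985Variational] (51) p. 286 «for A′ with values in 𝔤 the configuration D(A′) has values in 𝔤 also», (80) p. 290, (84)–(89) pp. 290–291, Prop. 4 (97)–(98) pp. 292–293;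
[Balaban1985BackgroundPropagators] (3.119) p. 419, (3.126) p. 420 (`H = GQ*(QGQ*)⁻¹`), p. 393 «The operators … are real».

WHAT IS PROVED (sorry-free, no definition).  ★★★ **`W80_isHermitian_trace_zero_at_record`** = ✓`Prop7SectET3WCurrentReality.W80_isHermitian_trace_zero_of_rows` at `Δx := DeltaPiSlotP F n K h c₀ cB a`
(slot rows ✓`Prop7SectET3RealityPInv.DeltaPiSlotP_toL2_star_of_regPr` ∕ `trace_DeltaPiSlotP_toL2_eq_zero_of_regPr` ∕ ✓`DeltaPiP_isSymmetric`, `0 ≤ a`), `hP4 :=` ✓`Prop7SectET3WCurrentProp4Rows.prop4Hyp_CmapTwS_conj_zeroJet` (its `cfgEquiv`-spelling of `ι` is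
the px14 spelling by `rfl`), `c₄ := e∕2 ≤ e`, `Δπ := currentCLM … (DeltaEtaSlot … U₀)` with `hΔπ :=` ✓`Prop7SectET3SlotCurrentRows.currentCLM_DeltaEtaSlot_isHermitian_traceless` (px14) — so that
the display's `hWR` text at the intended inhabitant `W80 ρ₂ τ₂ (bgOfCfg U₀) H̃ C̃ εC Ĵ (currentCLM … (DeltaEtaSlot … U₀))` of the opaque `Wf` (WORD (9) letter of record) holds at `U₀ ∈ 𝔘_k(ε₀)` in the
windows `10⁹L²e ≤ 1`, `10¹²L³ε₀ ≤ 1` GIVEN ONLY: `RC : Regime H̃ 0 C̃ bH 0 (40·(…)∕e²) (e∕2) 0 aC εC` (the Sect. C regime at the (W-X′) constants — px14 ✓`Prop7SectET3WChartConj`'s binder; its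
`norm_G` = the display's N06 row `norm_H₁`, its `quad` = `hP4.quadAnalytic`, the rest numerics), `hZC` ((Z-C): `C̃ (Y + z) = C̃ Y` for central `z`, `‖z‖ < δ`, `‖Y‖ < e∕2` — located chart
brick, not in the tree) and `hV0` ((R-V₀): the V₀-group current's sector row at these letters — located storey, not in the tree).
HONEST SCOPE.  A by-name composition; no estimate; nothing of [Balaban1985Variational] Props 3–4 or [Balaban1985BackgroundPropagators] is asserted; the EX stub is not touched.

References: T. Bałaban, CMP **102** (1985) 277–309 [Balaban1985Variational] ((44)–(51) pp.285–286, (80) p.290, (84)–(89) pp.290–291, (97)–(98) pp.292–293, (115) p.294); CMP **99**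
(1985) 389–434 [Balaban1985BackgroundPropagators] ((3.119) p.419, (3.126) p.420, p.393).
-/

set_option autoImplicit false

noncomputable section

open scoped InnerProductSpace ComplexConjugate Matrix.Norms.L2Operator BigOperators

namespace Summit.QuantumFields.YangMills.Theorems.Prop7SectET3WCurrentRealityAtRecord

open Literature.MathematicalPhysics.QuantumFieldTheory.Balaban1983to89
open Literature.MathematicalPhysics.QuantumFieldTheory.Balaban1983to89.T3ContinuumYM3Torus
open T3SectALandauChart (eta eta_pos)
open T3PrintedRegularMinimiser (RegPr)
open B9SectCLatticeCarrier (Bond)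
open B11Eq115Space (NegSup NegSize Space115 JetSup levWeight)
open B11Eq111FrakG (nabla115)
open B11Eq174Chart (Regime)
open B11Prop6Scheme (Prop4Hyp)
open B11Eq80Current (W80)
open B11Eq90V0GroupComposed (curV0full)
open B11Eq98CurrentSlot (Jcur)
open B11Eq98V0primeCurrentSlots (rieszτ)
open B9Eq3119DeltaPiCarrier (currentCLM)
open Summit.QuantumFields.YangMills.Theorems.Prop7SectET3Transport (periodsT3 siteEquiv bondEquiv bgOfCfg cfgEquiv)
open Summit.QuantumFields.YangMills.Theorems.Prop7SectET3HilbertLetters (W₂ frobEquiv toL2)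
open Summit.QuantumFields.YangMills.Theorems.Prop7SectET3CurvedPropagators (H1f)
open Summit.QuantumFields.YangMills.Theorems.Prop7SectET3WilsonHessian (DeltaEtaSlot)
open Summit.QuantumFields.YangMills.Theorems.Prop7SectET3DeltaPiPInv (DeltaPiSlotP DeltaPiP_isSymmetric)
open Summit.QuantumFields.YangMills.Theorems.Prop7SymAvgTwSym (CmapTwS)
open Summit.QuantumFields.YangMills.Theorems.Prop7SectET3RealityPInv (DeltaPiSlotP_toL2_star_of_regPr trace_DeltaPiSlotP_toL2_eq_zero_of_regPr)
open Summit.QuantumFields.YangMills.Theorems.Prop7SectET3WCurrentProp4Rows (prop4Hyp_CmapTwS_conj_zeroJet)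
open Summit.QuantumFields.YangMills.Theorems.Prop7SectET3SlotCurrentRows (currentCLM_DeltaEtaSlot_isHermitian_traceless)
open Summit.QuantumFields.YangMills.Theorems.Prop7SectET3WCurrentReality (W80_isHermitian_trace_zero_of_rows)

/-! ## §1 ★★★ The member corollary at the letters of record: `H̃ := H1f … DeltaPiSlotP … U₀` (EX namer WORD (9) 2026-08-28T23:58:13Z), `Δ̃π := currentCLM frobEquiv (fun _ ↦ K−n) (nabla115 η (bgOfCfg F K U₀)) (DeltaEtaSlot F n K c₀ U₀)` (px14 ✓p678511) -/

section Record

variable (F : T3Family) (n K : ℕ) (h : n ≤ K) (c₀ cB a : ℝ) [Fact (0 < c₀)] [Fact (0 < cB)] [Fact (0 < (F.L : ℝ))] [Fact (0 < ((F.L : ℝ)⁻¹) ^ (K - n))]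

/-- ★★★ **THE DISPLAY'S `hWR` AT THE (W-X′) LETTERS OF RECORD — `Δx := DeltaPiSlotP` for `H̃` (g2 ✓p669809 `DeltaPiSlotP_toL2_star_of_regPr`∕`trace_DeltaPiSlotP_toL2_eq_zero_of_regPr` + ✓`DeltaPiP_isSymmetric`, `0 ≤ a`), `Prop4Hyp C̃` BY NAME (g2 ✓`prop4Hyp_CmapTwS_conj_zeroJet`:
`C₂ := 40·(2·(3·(2e + 2700Lε₀)))∕e²`, `c₄ := e∕2`), `Δ̃π := currentCLM … (DeltaEtaSlot … U₀)` with its sector row BY NAME (px14 ✓`currentCLM_DeltaEtaSlot_isHermitian_traceless`):** at `U₀ ∈ 𝔘_k(ε₀)` in the windows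
`10⁹L²e ≤ 1`, `10¹²L³ε₀ ≤ 1`, for every Hermitian-traceless-valued `A′` with `‖A′‖ < a_C`, `W80 ρ₂ τ₂ (bgOfCfg F K U₀) H̃ C̃ εC (Jcur (bgOfCfg F K U₀)) Δ̃π A′` is Hermitian-traceless-valued — GIVEN ONLY
the Sect. C regime `RC` of `(H̃, C̃)` at those constants (its `norm_G` = the display's `norm_H₁`), the central invariance `hZC` of `C̃` ((Z-C)) and the V₀-group current's sector row `hV0` ((R-V₀)).
[cite: Balaban1985Variational, (51) p.286, (80) p.290, (84)–(89) pp.290–291, Prop. 4 (97)–(98) pp.292–293; Balaban1985BackgroundPropagators, (3.126) p.420, p.393] -/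
theorem W80_isHermitian_trace_zero_at_record (ha : 0 ≤ a)
    {ε₀ e : ℝ} (hε₀ : 0 < ε₀) (he : 0 < e) (hWe : 10 ^ 9 * (F.L : ℝ) ^ 2 * e ≤ 1) (hWε : 10 ^ 12 * (F.L : ℝ) ^ 3 * ε₀ ≤ 1)
    (U₀ : GaugeField (F.P K) 0 (Matrix.specialUnitaryGroup (Fin 2) ℂ)) (hreg : RegPr F n K ε₀ U₀)
    {bH aC εC : ℝ}
    (RC : Regime (H1f F n K h c₀ cB a (DeltaPiSlotP F n K h c₀ cB a) U₀) 0
      (fun A' : Space115 (F.L : ℝ) (((F.L : ℝ)⁻¹) ^ (K - n)) (fun _ : Bond 3 (periodsT3 F K) => K - n)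
        (fun _ : Bond 3 (periodsT3 F K) × Fin 3 => K - n) (nabla115 (((F.L : ℝ)⁻¹) ^ (K - n)) (bgOfCfg F K U₀)) =>
          (-Complex.I) • CmapTwS F n K h U₀ (((((eta F n K : ℝ) : ℂ)) * Complex.I) • fun b : PBond (F.P K) 0 => JetSup.equiv _ _ _ A' (bondEquiv F K b)))
      bH 0 (40 * (2 * (3 * (2 * e + 2700 * (F.L : ℝ) * ε₀))) / e ^ 2) (e / 2) 0 aC εC)
    {δ : ℝ} (hδ : 0 < δ)
    (hZC : ∀ Y : Space115 (F.L : ℝ) (((F.L : ℝ)⁻¹) ^ (K - n)) (fun _ : Bond 3 (periodsT3 F K) => K - n)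
        (fun _ : Bond 3 (periodsT3 F K) × Fin 3 => K - n) (nabla115 (((F.L : ℝ)⁻¹) ^ (K - n)) (bgOfCfg F K U₀)), ‖Y‖ < e / 2 →
      ∀ z : Space115 (F.L : ℝ) (((F.L : ℝ)⁻¹) ^ (K - n)) (fun _ : Bond 3 (periodsT3 F K) => K - n)
        (fun _ : Bond 3 (periodsT3 F K) × Fin 3 => K - n) (nabla115 (((F.L : ℝ)⁻¹) ^ (K - n)) (bgOfCfg F K U₀)),
        (∀ b, ∃ c : ℂ, JetSup.equiv _ _ _ z b = c • (1 : Matrix (Fin 2) (Fin 2) ℂ)) → ‖z‖ < δ →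
        (-Complex.I) • CmapTwS F n K h U₀ (((((eta F n K : ℝ) : ℂ)) * Complex.I) • fun b : PBond (F.P K) 0 => JetSup.equiv _ _ _ (Y + z) (bondEquiv F K b))
          = (-Complex.I) • CmapTwS F n K h U₀ (((((eta F n K : ℝ) : ℂ)) * Complex.I) • fun b : PBond (F.P K) 0 => JetSup.equiv _ _ _ Y (bondEquiv F K b)))
    (hV0 : ∀ A' : Space115 (F.L : ℝ) (((F.L : ℝ)⁻¹) ^ (K - n)) (fun _ : Bond 3 (periodsT3 F K) => K - n)
        (fun _ : Bond 3 (periodsT3 F K) × Fin 3 => K - n) (nabla115 (((F.L : ℝ)⁻¹) ^ (K - n)) (bgOfCfg F K U₀)), ‖A'‖ < aC →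
      (∀ b, (JetSup.equiv _ _ _ A' b).IsHermitian ∧ (JetSup.equiv _ _ _ A' b).trace = 0) →
      ∀ b, (NegSup.equiv _ _ (curV0full (rieszτ frobEquiv) (LinearMap.toContinuousLinearMap (Matrix.traceLinearMap (Fin 2) ℂ ℂ)) (bgOfCfg F K U₀)
          (H1f F n K h c₀ cB a (DeltaPiSlotP F n K h c₀ cB a) U₀)
          (fun A' : Space115 (F.L : ℝ) (((F.L : ℝ)⁻¹) ^ (K - n)) (fun _ : Bond 3 (periodsT3 F K) => K - n)
            (fun _ : Bond 3 (periodsT3 F K) × Fin 3 => K - n) (nabla115 (((F.L : ℝ)⁻¹) ^ (K - n)) (bgOfCfg F K U₀)) =>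
              (-Complex.I) • CmapTwS F n K h U₀ (((((eta F n K : ℝ) : ℂ)) * Complex.I) • fun b : PBond (F.P K) 0 => JetSup.equiv _ _ _ A' (bondEquiv F K b)))
          εC A') b).IsHermitian ∧
        (NegSup.equiv _ _ (curV0full (rieszτ frobEquiv) (LinearMap.toContinuousLinearMap (Matrix.traceLinearMap (Fin 2) ℂ ℂ)) (bgOfCfg F K U₀)
          (H1f F n K h c₀ cB a (DeltaPiSlotP F n K h c₀ cB a) U₀)
          (fun A' : Space115 (F.L : ℝ) (((F.L : ℝ)⁻¹) ^ (K - n)) (fun _ : Bond 3 (periodsT3 F K) => K - n)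
            (fun _ : Bond 3 (periodsT3 F K) × Fin 3 => K - n) (nabla115 (((F.L : ℝ)⁻¹) ^ (K - n)) (bgOfCfg F K U₀)) =>
              (-Complex.I) • CmapTwS F n K h U₀ (((((eta F n K : ℝ) : ℂ)) * Complex.I) • fun b : PBond (F.P K) 0 => JetSup.equiv _ _ _ A' (bondEquiv F K b)))
          εC A') b).trace = 0)
    (A' : Space115 (F.L : ℝ) (((F.L : ℝ)⁻¹) ^ (K - n)) (fun _ : Bond 3 (periodsT3 F K) => K - n)
      (fun _ : Bond 3 (periodsT3 F K) × Fin 3 => K - n) (nabla115 (((F.L : ℝ)⁻¹) ^ (K - n)) (bgOfCfg F K U₀)))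
    (hA' : ‖A'‖ < aC) (hA'S : ∀ b, (JetSup.equiv _ _ _ A' b).IsHermitian ∧ (JetSup.equiv _ _ _ A' b).trace = 0) (b : Bond 3 (periodsT3 F K)) :
    (NegSup.equiv _ _ (W80 (rieszτ frobEquiv) (LinearMap.toContinuousLinearMap (Matrix.traceLinearMap (Fin 2) ℂ ℂ)) (bgOfCfg F K U₀)
        (H1f F n K h c₀ cB a (DeltaPiSlotP F n K h c₀ cB a) U₀)
        (fun A' : Space115 (F.L : ℝ) (((F.L : ℝ)⁻¹) ^ (K - n)) (fun _ : Bond 3 (periodsT3 F K) => K - n)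
          (fun _ : Bond 3 (periodsT3 F K) × Fin 3 => K - n) (nabla115 (((F.L : ℝ)⁻¹) ^ (K - n)) (bgOfCfg F K U₀)) =>
            (-Complex.I) • CmapTwS F n K h U₀ (((((eta F n K : ℝ) : ℂ)) * Complex.I) • fun b : PBond (F.P K) 0 => JetSup.equiv _ _ _ A' (bondEquiv F K b)))
        εC (Jcur (bgOfCfg F K U₀))
        (currentCLM frobEquiv (fun _ : Bond 3 (periodsT3 F K) × Fin 3 => K - n) (nabla115 (((F.L : ℝ)⁻¹) ^ (K - n)) (bgOfCfg F K U₀)) (DeltaEtaSlot F n K c₀ U₀))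
        A') b).IsHermitian ∧
    (NegSup.equiv _ _ (W80 (rieszτ frobEquiv) (LinearMap.toContinuousLinearMap (Matrix.traceLinearMap (Fin 2) ℂ ℂ)) (bgOfCfg F K U₀)
        (H1f F n K h c₀ cB a (DeltaPiSlotP F n K h c₀ cB a) U₀)
        (fun A' : Space115 (F.L : ℝ) (((F.L : ℝ)⁻¹) ^ (K - n)) (fun _ : Bond 3 (periodsT3 F K) => K - n)
          (fun _ : Bond 3 (periodsT3 F K) × Fin 3 => K - n) (nabla115 (((F.L : ℝ)⁻¹) ^ (K - n)) (bgOfCfg F K U₀)) =>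
            (-Complex.I) • CmapTwS F n K h U₀ (((((eta F n K : ℝ) : ℂ)) * Complex.I) • fun b : PBond (F.P K) 0 => JetSup.equiv _ _ _ A' (bondEquiv F K b)))
        εC (Jcur (bgOfCfg F K U₀))
        (currentCLM frobEquiv (fun _ : Bond 3 (periodsT3 F K) × Fin 3 => K - n) (nabla115 (((F.L : ℝ)⁻¹) ^ (K - n)) (bgOfCfg F K U₀)) (DeltaEtaSlot F n K c₀ U₀))
        A') b).trace = 0 := by
  have hΔx := DeltaPiSlotP_toL2_star_of_regPr F n K h c₀ cB a U₀ ha hε₀ he hWe hWε hreg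
  have hΔtr := trace_DeltaPiSlotP_toL2_eq_zero_of_regPr F n K h c₀ cB a U₀ ha hε₀ he hWe hWε hreg
  have hΔsymm : (DeltaPiSlotP F n K h c₀ cB a U₀).IsSymmetric := DeltaPiP_isSymmetric (F := F) (n := n) (K := K) (h := h) (c₀ := c₀) (cB := cB) (a := a) U₀
  have hP4 := prop4Hyp_CmapTwS_conj_zeroJet F h hε₀ he hWe hWε U₀ hreg
  exact W80_isHermitian_trace_zero_of_rows F n K h c₀ cB a (DeltaPiSlotP F n K h c₀ cB a) hε₀ he hWe hWε U₀ hreg hΔx hΔtr hΔsymm RC hP4 (by linarith) _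
    (fun Y hY b' => currentCLM_DeltaEtaSlot_isHermitian_traceless F n K c₀ U₀ (fun _ : Bond 3 (periodsT3 F K) × Fin 3 => K - n)
      (nabla115 (((F.L : ℝ)⁻¹) ^ (K - n)) (bgOfCfg F K U₀)) Y hY b') hδ hZC hV0 A' hA' hA'S b

end Record

end Summit.QuantumFields.YangMills.Theorems.Prop7SectET3WCurrentRealityAtRecord

end
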